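import Literature.AlgebraicTopology.Homotopy.WhiteheadTheorem
import Literature.AlgebraicTopology.Homotopy.WhiteheadContractibleLeaves
import HarnessLib

/-!
# Hatcher's Cor. A.12 (closed manifolds) from Milnor's Corollary 1 (separable manifolds)

Topic `Literature/AlgebraicTopology/Homotopy`. A second, independent reduction of the tree's
named fact `Literature.AlgebraicTopology.Homotopy.exists_cwComplex_homotopyEquiv_of_compactSpace`
(Hatcher, *Algebraic Topology* (2002), Cor. A.12: a compact manifold is homotopy equivalent to a
CW complex; stated for closed topological `n`-manifolds) — besides the Appendix route
A.7 ⇒ A.12 of `CompactManifoldCWType.lean` / `CompactENRCWType.lean`: it is the compact case of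
Milnor's Corollary 1 (*On spaces having the homotopy type of a CW-complex* (1959), p. 272:
"Every separable manifold belongs to the class `𝒲₀`"), vendored as the named fact
`Literature.AlgebraicTopology.Homotopy.Manifold.exists_cwComplex_homotopyEquiv`
(`WhiteheadContractibleLeaves.lean`), since a compact manifold is second countable
(`ChartedSpace.secondCountable_of_sigmaCompact`). PROVED:

* `Literature.AlgebraicTopology.Homotopy.exists_cwComplex_homotopyEquiv_of_compactSpace_of_milnor`.

So the Cor. A.12 fact is discharged by whichever of Hatcher's Thm. A.7 / Milnor's Cor. 1 is
discharged first. No `sorry`.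

## References

* A. Hatcher, *Algebraic Topology*, CUP (2002), Appendix, Cor. A.12 (p. 529). [HatcherAT2002]
* J. Milnor, *On spaces having the homotopy type of a CW-complex*, Trans. AMS 90 (1959),
  Cor. 1 (p. 272). [Milnor1959]
-/

noncomputable section

universe u

namespace Literature.AlgebraicTopology.Homotopy

/-- **Cor. A.12 for closed manifolds from Milnor's Corollary 1** (GIVEN the named fact
`Manifold.exists_cwComplex_homotopyEquiv`, Milnor 1959, Cor. 1): a compact Hausdorff topological
`n`-manifold is second countable (`ChartedSpace.secondCountable_of_sigmaCompact`), hence of the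
homotopy type of a (countable) CW complex. [cite: HatcherAT2002, Cor. A.12] [cite: Milnor1959, Cor. 1] -/
theorem exists_cwComplex_homotopyEquiv_of_compactSpace_of_milnor
    (hM : Manifold.exists_cwComplex_homotopyEquiv.{u}) :
    exists_cwComplex_homotopyEquiv_of_compactSpace.{u} := by
  intro M _ _ _ n _
  haveI : SecondCountableTopology M :=
    ChartedSpace.secondCountable_of_sigmaCompact (EuclideanSpace ℝ (Fin n)) M
  obtain ⟨C, i1, i2, i3, -, hC⟩ := hM n M
  exact ⟨C, i1, i2, i3, hC⟩

end Literature.AlgebraicTopology.Homotopy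

end
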